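import Literature.AlgebraicGeometry.HodgeTheory.FermatAokiSubvarietyCodimension
import HarnessLib

/-!
# The stabiliser of Aoki's subvariety `Y ⊂ X^{p-1}ₘ` contains `G₀ ∩ Ker(1, …, 1, -p)` (Prop. 3-1 (ii), one inclusion)

Family `hodge`, layer `Literature/AlgebraicGeometry/HodgeTheory`. PROOF FILE (sequel of
`FermatAokiSubvarietyCodimension`, everything proved, no named fact) for the named fact
`Aoki1987_claim_pStandard` of `FermatInductiveClaims` — Aoki, J. Math. Soc. Japan 39 (1987),
PROPOSITION 3-1 (ii) (p. 389): "`G_Y = G₀ ∩ Ker σ`. In particular `G_Y ⊂ Ker σ`", where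
`G_Y = {g ∈ G | Yᵍ = Y}` is the stabiliser of `Y` in the group `G = G^{p-1}ₘ` of diagonal
symmetries `(ζ₀ : ⋯ : ζ_p)` of `X^{p-1}ₘ`, `G₀ = {ζ₀ᵈ = ⋯ = ζ_{p-1}ᵈ}` (projectively; `G₀ ⊂ G_{ij}`,
p. 391) and `σ` here is the character `(1, 1, …, 1, -p)` of the notation list of §3. Printed proof
of the inclusion `G₀ ∩ Ker σ ⊆ G_Y` (p. 390): "`Yᵍ` (`g ∈ G`) is defined by the following equations:
`Σᵢ ζᵢ^{-kd} xᵢ^{kd} = 0` (`1 ≤ k ≤ r`), `x_pᵖ - σ(g) c x₀x₁⋯x_{p-1} = 0`. It follows that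
`G₀ ∩ Ker σ ⊂ G_Y`."

This file PROVES that inclusion on the tree's carriers, for the scheme automorphisms
`diagonalAut F ha : X_F ⟶ X_F` (`HodgeTheory/DiagonalSymmetry`) of the standard model
`X²ʳₘ = fermatHypersurface (2r) m` and the Zariski-closed subset
`Aoki1987.fermatAokiSection m r d c ⊆ X²ʳₘ` (`FermatAokiSubvarietyCodimension`), and indeed for
every `a` in the diagonal stabiliser of the Fermat form (not only roots of unity):

* `diagonalProjMap_preimage_zeroLocus` — `[z] ↦ [a • z]` pulls `V₊(S) ⊆ ℙⁿ⁺¹` back to `V₊(σ_a S)`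
  (`σ_a : xᵢ ↦ aᵢ xᵢ`; on points `Proj.map` is `𝔭 ↦ σ_a⁻¹ 𝔭`);
* `Aoki1987.aeval_C_mul_esymm` — `e_k(β y₀, …, β y_{p-1}) = βᵏ e_k(y)` (homogeneity of `e_k`);
* `Aoki1987.aeval_diagonalSubst_f0`, `Aoki1987.aeval_diagonalSubst_esymm` — for `a` with
  `a₀ᵈ = ⋯ = a_{p-1}ᵈ = β` and `a_pᵖ = a₀⋯a_{p-1}` ("`g ∈ G₀ ∩ Ker σ`"), `σ_a f₀ = a_pᵖ · f₀` and
  `σ_a e_k(xᵈ) = βᵏ · e_k(xᵈ)`: the equations of `Yᵍ` are unit multiples of those of `Y`;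
* `Aoki1987.preimage_aokiSubvariety_diagonalProjMap` — hence `[z] ↦ [a • z]` maps `Y ⊆ ℙᵖ` onto
  itself (`V₊(σ_a S) = V₊(S)`), and
* **`Aoki1987.preimage_fermatAokiSection_diagonalAut`** — the automorphism `g_a` of `X²ʳₘ`
  preserves `Y ∩ X²ʳₘ`: `g_a⁻¹(Y) = Y` (`diagonalAut_left_comp_ι`).

This is the geometric input "`h^*[Y] = [Y]` for `h ∈ G_Y ⊇ G₀ ∩ Ker σ`" of Aoki's §4 ((4.1) and the
orbit sums over `G₀/G_Y` in Prop. 4-3), to be combined with cycle classes when those exist.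

## What is NOT here

The reverse inclusion `G_Y ⊆ G₀ ∩ Ker σ` (the points `P_t = (1 : ξᵗ : ξ²ᵗ : ⋯ : ᵖ√p·?) ∈ Y` with
`P_t ∉ Yᵍ`, p. 390), Prop. 3-1 (iii)–(v) (degree and rational equivalences), §4.

## References

* [Aoki1987] N. Aoki, Some new algebraic cycles on Fermat varieties, J. Math. Soc. Japan 39 (1987)
  385–396: §3 notation (p. 389), Prop. 3-1 (ii) and its proof (pp. 389–390), `G_{ij} ⊃ G₀`
  (p. 391) (text read).
* [Hartshorne1977] R. Hartshorne, Algebraic Geometry (1977), II Example 7.1.1 (`PGL` acting on `ℙⁿ`).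
-/

noncomputable section

open CategoryTheory AlgebraicGeometry MvPolynomial Finset

namespace Literature.AlgebraicGeometry.HodgeTheory

open Literature.AlgebraicGeometry.Motives

/-! ### `[z] ↦ [a • z]` pulls `V₊(S)` back to `V₊(σ_a S)` -/

/-- **`[z] ↦ [a • z]` pulls `V₊(S)` back to `V₊(σ_a S)`** (`σ_a : xᵢ ↦ aᵢxᵢ`): on points, Mathlib's
`Proj.map σ_a` is `𝔭 ↦ σ_a⁻¹(𝔭)`, and `S ⊆ σ_a⁻¹ 𝔭 ↔ σ_a S ⊆ 𝔭` (as for `substMapHom` in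
`Motives/LinesGenerateChowOneLinear`). [cite: Hartshorne1977, II Example 7.1.1] -/
theorem diagonalProjMap_preimage_zeroLocus {n : ℕ} (a : Fin (n + 2) → ℂˣ)
    (S : Set (MvPolynomial (Fin (n + 2)) ℂ)) :
    letI := MvPolynomial.gradedAlgebra (σ := Fin (n + 2)) (R := ℂ)
    (diagonalProjMap a).left.base ⁻¹'
        ProjectiveSpectrum.zeroLocus (MvPolynomial.homogeneousSubmodule (Fin (n + 2)) ℂ) S =
      ProjectiveSpectrum.zeroLocus (MvPolynomial.homogeneousSubmodule (Fin (n + 2)) ℂ)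
        (aeval (diagonalSubst a) '' S) := by
  letI := MvPolynomial.gradedAlgebra (σ := Fin (n + 2)) (R := ℂ)
  ext p
  change S ⊆ aeval (diagonalSubst a) ⁻¹'
      ((p : ProjectiveSpectrum (MvPolynomial.homogeneousSubmodule (Fin (n + 2)) ℂ)).asHomogeneousIdeal :
        Set _) ↔
    aeval (diagonalSubst a) '' S ⊆
      ((p : ProjectiveSpectrum (MvPolynomial.homogeneousSubmodule (Fin (n + 2)) ℂ)).asHomogeneousIdeal :
        Set _)
  exact Set.image_subset_iff.symm

namespace Aoki1987

variable {R : Type*} [CommRing R]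

/-! ### The equations of `Yᵍ` are unit multiples of those of `Y` for `g ∈ G₀ ∩ Ker(1, …, 1, -p)` -/

/-- **Homogeneity of `e_k`**: `e_k(β y₀, …, β y_{q-1}) = βᵏ · e_k(y₀, …, y_{q-1})` for any
substitution `y`. [folklore] -/
theorem aeval_C_mul_esymm {τ : Type*} [Fintype τ] {S : Type*} [CommRing S] [Algebra R S]
    (β : S) (g : τ → S) (k : ℕ) :
    aeval (fun i ↦ β * g i) (esymm τ R k) = β ^ k * aeval g (esymm τ R k) := by
  classical
  simp only [esymm, map_sum, map_prod, aeval_X, Finset.mul_sum]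
  refine Finset.sum_congr rfl fun t ht ↦ ?_
  rw [Finset.prod_mul_distrib, Finset.prod_const, (Finset.mem_powersetCard.mp ht).2]

variable (r d : ℕ)

/-- **`σ_a f₀ = a_pᵖ · f₀`** for `a_pᵖ = a₀a₁⋯a_{p-1}` ("`g ∈ Ker σ`", `σ = (1, …, 1, -p)`):
`σ_a(x_pᵖ - c·x₀⋯x_{p-1}) = a_pᵖ x_pᵖ - c·(a₀⋯a_{p-1})·x₀⋯x_{p-1}`.
[cite: Aoki1987, proof of Prop. 3-1 (ii) (p. 390: the equation x_pᵖ - σ(g) c x₀⋯x_{p-1} = 0 of Yᵍ)] -/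
theorem aeval_diagonalSubst_f0 {a : Fin (2 * r + 2) → ℂˣ}
    (hρ : a (Fin.last (2 * r + 1)) ^ (2 * r + 1) = ∏ i : Fin (2 * r + 1), a (Fin.castSucc i)) (c : ℂ) :
    aeval (diagonalSubst a)
        (X (Fin.last (2 * r + 1)) ^ (2 * r + 1) - C c * ∏ i : Fin (2 * r + 1), X (Fin.castSucc i) :
          MvPolynomial (Fin (2 * r + 2)) ℂ) =
      C ((a (Fin.last (2 * r + 1)) : ℂ) ^ (2 * r + 1)) *
        (X (Fin.last (2 * r + 1)) ^ (2 * r + 1) - C c * ∏ i : Fin (2 * r + 1), X (Fin.castSucc i)) := by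
  have hρ' : ((a (Fin.last (2 * r + 1)) : ℂ) ^ (2 * r + 1)) = ∏ i : Fin (2 * r + 1), (a (Fin.castSucc i) : ℂ) := by
    rw [← Units.val_pow_eq_pow_val, hρ, Units.coe_prod]
  rw [map_sub, map_mul, map_pow, map_prod, aeval_C, algebraMap_eq]
  simp_rw [aeval_X, diagonalSubst_apply]
  rw [Finset.prod_mul_distrib, ← map_prod, ← hρ', mul_pow, ← map_pow]
  ring

/-- **`σ_a e_k(x₀ᵈ, …, x_{p-1}ᵈ) = βᵏ · e_k(x₀ᵈ, …, x_{p-1}ᵈ)`** for `a₀ᵈ = ⋯ = a_{p-1}ᵈ = β`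
("`g ∈ G₀`"). [cite: Aoki1987, proof of Prop. 3-1 (ii) (p. 390: the equations Σ ζᵢ^{-kd} xᵢ^{kd} = 0 of Yᵍ)] -/
theorem aeval_diagonalSubst_esymm {a : Fin (2 * r + 2) → ℂˣ} {β : ℂ}
    (hβ : ∀ i : Fin (2 * r + 1), ((a (Fin.castSucc i)) : ℂ) ^ d = β) (k : ℕ) :
    aeval (diagonalSubst a)
        (aeval (fun i : Fin (2 * r + 1) ↦ (X (Fin.castSucc i) : MvPolynomial (Fin (2 * r + 2)) ℂ) ^ d)
          (esymm (Fin (2 * r + 1)) ℂ k)) =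
      C (β ^ k) * aeval (fun i : Fin (2 * r + 1) ↦
        (X (Fin.castSucc i) : MvPolynomial (Fin (2 * r + 2)) ℂ) ^ d) (esymm (Fin (2 * r + 1)) ℂ k) := by
  rw [← AlgHom.comp_apply, MvPolynomial.comp_aeval]
  have h : (fun i : Fin (2 * r + 1) ↦ aeval (diagonalSubst a)
      ((X (Fin.castSucc i) : MvPolynomial (Fin (2 * r + 2)) ℂ) ^ d)) =
      fun i ↦ C β * (X (Fin.castSucc i) : MvPolynomial (Fin (2 * r + 2)) ℂ) ^ d := by
    funext i
    rw [map_pow, aeval_X, diagonalSubst_apply, mul_pow, ← map_pow, hβ i]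
  rw [h, aeval_C_mul_esymm, map_pow]

/-- For `g ∈ G₀ ∩ Ker σ` the substituted equations lie in the ideal of the equations of `Y`.
[cite: Aoki1987, proof of Prop. 3-1 (ii) (p. 390)] -/
theorem aeval_diagonalSubst_image_subset_span {a : Fin (2 * r + 2) → ℂˣ} {β : ℂ}
    (hβ : ∀ i : Fin (2 * r + 1), ((a (Fin.castSucc i)) : ℂ) ^ d = β)
    (hρ : a (Fin.last (2 * r + 1)) ^ (2 * r + 1) = ∏ i : Fin (2 * r + 1), a (Fin.castSucc i)) (c : ℂ) :
    aeval (diagonalSubst a) '' aokiEquations r d c ⊆ (Ideal.span (aokiEquations r d c) : Set _) := by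
  rintro _ ⟨s, hs, rfl⟩
  rcases hs with rfl | ⟨k, hk, rfl⟩
  · rw [aeval_diagonalSubst_f0 r hρ c]
    exact Ideal.mul_mem_left _ _ (Ideal.subset_span (f0_mem_aokiEquations r d c))
  · change aeval (diagonalSubst a) (aeval _ (esymm (Fin (2 * r + 1)) ℂ k)) ∈ _
    rw [aeval_diagonalSubst_esymm r d hβ k]
    exact Ideal.mul_mem_left _ _ (Ideal.subset_span (esymm_mem_aokiEquations r d c hk))

/-- Conversely the equations of `Y` lie in the ideal of the substituted ones (the multipliers
`a_pᵖ`, `βᵏ` are units). [cite: Aoki1987, proof of Prop. 3-1 (ii) (p. 390)] -/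
theorem subset_span_aeval_diagonalSubst_image {a : Fin (2 * r + 2) → ℂˣ} {β : ℂ}
    (hβ : ∀ i : Fin (2 * r + 1), ((a (Fin.castSucc i)) : ℂ) ^ d = β)
    (hρ : a (Fin.last (2 * r + 1)) ^ (2 * r + 1) = ∏ i : Fin (2 * r + 1), a (Fin.castSucc i)) (c : ℂ) :
    aokiEquations r d c ⊆ (Ideal.span (aeval (diagonalSubst a) '' aokiEquations r d c) : Set _) := by
  have hβ0 : β ≠ 0 := by
    rw [← hβ 0]
    exact pow_ne_zero _ (a (Fin.castSucc 0)).ne_zero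
  intro s hs
  have hmem : aeval (diagonalSubst a) s ∈ Ideal.span (aeval (diagonalSubst a) '' aokiEquations r d c) :=
    Ideal.subset_span ⟨s, hs, rfl⟩
  rcases hs with rfl | ⟨k, hk, rfl⟩
  · set u : ℂ := ((a (Fin.last (2 * r + 1)) : ℂ) ^ (2 * r + 1)) with hu
    have hu0 : u ≠ 0 := pow_ne_zero _ (a (Fin.last (2 * r + 1))).ne_zero
    rw [aeval_diagonalSubst_f0 r hρ c] at hmem
    have h := Ideal.mul_mem_left _ (C u⁻¹) hmem
    rwa [← mul_assoc, ← map_mul, inv_mul_cancel₀ hu0, map_one, one_mul] at h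
  · change aeval (diagonalSubst a) (aeval _ (esymm (Fin (2 * r + 1)) ℂ k)) ∈ _ at hmem
    rw [aeval_diagonalSubst_esymm r d hβ k] at hmem
    have h := Ideal.mul_mem_left _ (C (β ^ k)⁻¹) hmem
    rwa [← mul_assoc, ← map_mul, inv_mul_cancel₀ (pow_ne_zero k hβ0), map_one, one_mul] at h

/-! ### `Yᵍ = Y` for `g ∈ G₀ ∩ Ker(1, …, 1, -p)` -/

/-- **`[z] ↦ [a • z]` maps `Y ⊆ ℙᵖ` onto itself** for `a₀ᵈ = ⋯ = a_{p-1}ᵈ`, `a_pᵖ = a₀⋯a_{p-1}`: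
its preimage `V₊(σ_a S)` equals `V₊(S) = Y` since both sets of equations generate the same ideal.
[cite: Aoki1987, Prop. 3-1 (ii) (p. 389) and its proof (p. 390)] -/
theorem preimage_aokiSubvariety_diagonalProjMap {a : Fin (2 * r + 2) → ℂˣ} {β : ℂ}
    (hβ : ∀ i : Fin (2 * r + 1), ((a (Fin.castSucc i)) : ℂ) ^ d = β)
    (hρ : a (Fin.last (2 * r + 1)) ^ (2 * r + 1) = ∏ i : Fin (2 * r + 1), a (Fin.castSucc i)) (c : ℂ) :
    (diagonalProjMap a).left.base ⁻¹' aokiSubvariety r d c = aokiSubvariety r d c := by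
  letI := MvPolynomial.gradedAlgebra (σ := Fin (2 * r + 2)) (R := ℂ)
  change (diagonalProjMap a).left.base ⁻¹'
      ProjectiveSpectrum.zeroLocus (MvPolynomial.homogeneousSubmodule (Fin (2 * r + 2)) ℂ)
        (aokiEquations r d c) =
    ProjectiveSpectrum.zeroLocus (MvPolynomial.homogeneousSubmodule (Fin (2 * r + 2)) ℂ)
      (aokiEquations r d c)
  rw [diagonalProjMap_preimage_zeroLocus]
  refine Set.Subset.antisymm ?_ ?_
  · rw [← ProjectiveSpectrum.zeroLocus_span _ (aeval (diagonalSubst a) '' aokiEquations r d c)]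
    exact ProjectiveSpectrum.zeroLocus_anti_mono _ (subset_span_aeval_diagonalSubst_image r d hβ hρ c)
  · rw [← ProjectiveSpectrum.zeroLocus_span _ (aokiEquations r d c)]
    exact ProjectiveSpectrum.zeroLocus_anti_mono _ (aeval_diagonalSubst_image_subset_span r d hβ hρ c)

variable {m : ℕ}

/-- **PROP. 3-1 (ii), the inclusion `G₀ ∩ Ker σ ⊆ G_Y`: the diagonal automorphism `g_a` of `X²ʳₘ`
preserves `Y`.** For `a` in the diagonal stabiliser of the Fermat form (e.g. `a ∈ μₘ²ʳ⁺²`) with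
`a₀ᵈ = ⋯ = a_{p-1}ᵈ` (`g ∈ G₀`) and `a_pᵖ = a₀⋯a_{p-1}` (`g ∈ Ker(1, …, 1, -p)`), the algebraic
automorphism `diagonalAut` of the standard model (`HodgeTheory/DiagonalSymmetry`) satisfies
`g_a⁻¹(Y ∩ X²ʳₘ) = Y ∩ X²ʳₘ` ("`Yᵍ = Y`", i.e. `g ∈ G_Y`): `g_a` covers `[z] ↦ [a • z]` on `ℙᵖ`
(`diagonalAut_left_comp_ι`), which preserves `Y` (`preimage_aokiSubvariety_diagonalProjMap`).
[cite: Aoki1987, Prop. 3-1 (ii) (p. 389: "G_Y = G₀ ∩ Ker σ") and its proof (p. 390: "It follows that G₀ ∩ Ker σ ⊂ G_Y")] -/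
theorem preimage_fermatAokiSection_diagonalAut {a : Fin (2 * r + 2) → ℂˣ}
    (ha : a ∈ diagonalStabilizer (fermatPolynomial ℂ (2 * r) m)) {β : ℂ}
    (hβ : ∀ i : Fin (2 * r + 1), ((a (Fin.castSucc i)) : ℂ) ^ d = β)
    (hρ : a (Fin.last (2 * r + 1)) ^ (2 * r + 1) = ∏ i : Fin (2 * r + 1), a (Fin.castSucc i)) (c : ℂ) :
    (diagonalAut (fermatPolynomial ℂ (2 * r) m) ha).left.base ⁻¹' fermatAokiSection m r d c =
      fermatAokiSection m r d c := by
  have hcomp : ∀ z : ↥(fermatHypersurface (2 * r) m).left,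
      (SmoothHypersurface.hypersurfaceι (fermatPolynomial ℂ (2 * r) m)).left.base
          ((diagonalAut (fermatPolynomial ℂ (2 * r) m) ha).left.base z) =
        (diagonalProjMap a).left.base
          ((SmoothHypersurface.hypersurfaceι (fermatPolynomial ℂ (2 * r) m)).left.base z) := by
    intro z
    have h := congrArg (fun f ↦ f.base z) (diagonalAut_left_comp_ι (fermatPolynomial ℂ (2 * r) m) ha)
    simpa using h
  ext z
  simp only [fermatAokiSection, Set.mem_preimage, hcomp]
  rw [← Set.mem_preimage, preimage_aokiSubvariety_diagonalProjMap r d hβ hρ c]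

end Aoki1987

end Literature.AlgebraicGeometry.HodgeTheory

end
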